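import Mathlib
import Literature.Combinatorics.Enumerative.PatternAvoidanceParity
import HarnessLib

/-!
# Even and odd `231`-avoiding involutions: `δ_n = EI_n(231) − OI_n(231)` satisfies `δ_n = δ_{n−1} − 2δ_{n−2}`,
# `δ_n ≡ 2 (mod 4)` and `δ_n ≠ 0` for `n ≥ 3` (Simion–Schmidt 1985, Proposition 6 and closing Remarks of §2)

Layer `Literature/Combinatorics/Enumerative`, namespace `Literature.Combinatorics.Enumerative.PermContainsPattern`;
continuation of `InvolutionsAvoiding231.lean` (`{231-avoiding involutions} = S_n(231, 312)`, `I_n(231) = 2^{n−1}`) and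
`PatternAvoidanceParity.lean` (the block sum `β ⊕ (1 ⊖ α)`, its sign, `sign w₀ = (−1)^{⌊n/2⌋}`); lane `lit-hodgefound`
(Track 2 foundations library; prover seat p13, generation 38, theme «pattern avoidance II: involutions and parity»).

## Source, verbatim

R. Simion, F. W. Schmidt, *Restricted permutations*, European J. Combin. **6** (1985) 383–406 [SimionSchmidt1985]
(open archive; held text `paper:doi-10-1016-s0195-6698-85-80052-4`, pp. 391–392 = chunks p0009–p0010), §2:

> **PROPOSITION 6.** For every `n ≥ 1`, and `p ∈ {231, 312}`, `I_n(p) = 2^{n−1}` and [`EI_n(p) − OI_n(p)` in closed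
> form through `α = (1 + i√7)/2`, `β = (1 − i√7)/2`].
> PROOF. … an alternate correspondence can be given, associating with each such `σ` a composition (i.e. ordered
> partition) of `n` into positive integers … Note also that `sign(σ) = (−1)^{Σ C(x_i, 2)}`, where `x_i` are the summands
> in the composition. … The ordinary generating function can be found … `1 + Σ {EI_n(231) − OI_n(231)} x^n = F(x, −1)` …
> The same results hold for `312`-avoiding involutions.
> REMARKS. … The difference `EI_n(231) − OI_n(231)` can be expressed as `δ_n = (2^{n/2}/√7) cos(θ₀ + nθ₁)` where
> `tan θ₀ = √7/3`, `tan θ₁ = √7`. This formula shows clearly the oscillatory nature of `δ_n`. As a final remark, we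
> mention that `δ_n ≠ 0` for `n ≥ 3`; indeed, the recurrence, `δ_n = δ_{n−1} − 2δ_{n−2}`, implies `δ_n ≡ 2 (mod 4)`,
> `n ≥ 3`.

## Formalisation

`δ_n` is the signed count `Σ_{σ ∈ S_n(231,312)} sign σ` (`S_n(231, 312)` = the `231`-avoiding involutions, by
`involution_and_av231_iff` of `InvolutionsAvoiding231.lean`).  §1: the block sum `β ⊕ (1 ⊖ α)` of `PatternAvoidanceParity`
avoids `312` iff `β` avoids `312` and `α` has no ascent (`not_contains_312_blockSum_iff`, via the tree's word lemma
`has312_append_max_iff`), i.e. `α = w₀` is the decreasing permutation — the printed «following `σ(k) = n`, we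
necessarily have the largest letters decreasingly ordered» — so a `231`-avoiding involution with `n` in position `m` is
`β ⊕ w₀^{(k+1)}` with `β ∈ S_m(231, 312)`, `k = n − m` (the composition structure of the printed proof: last summand
`k + 1`).  §2 ★★ `signSum_av231_av312_succ`: `δ_{n+1} = Σ_{m=0}^{n} (−1)^{⌊(n−m+1)/2⌋} δ_m` (the sign of the last block
`w₀^{(k+1)}` is `(−1)^{C(k+1, 2)} = (−1)^{⌊(k+1)/2⌋}`; fibres over the position of `n` exhausted by counting
`Σ_m 2^{m−1} = 2^n`).  §3 ★★ `signSum_av231_av312_rec`: **`δ_{n+3} = δ_{n+2} − 2 δ_{n+1}`** with `δ_0 = δ_1 = 1`,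
`δ_2 = 0`, `δ_3 = δ_4 = −2` (`(−1)^{⌊(j+3)/2⌋} = −(−1)^{⌊(j+1)/2⌋}`).  §4 ★★ **`δ_n ≡ 2 (mod 4)` and `δ_n ≠ 0` for
`n ≥ 3`** (`signSum_av231_av312_emod_four`, `signSum_av231_av312_ne_zero`).  §5: in terms of the numbers
`EI_n(231) = Nat.card {v // v² = 1, v avoids 231, sign v = 1}` and `OI_n(231)`: `EI − OI = δ_n`, `EI + OI = 2^{n−1}`,
hence ★ `EI_n(231) ≠ OI_n(231)` for `n ≥ 3` (and for `312` alike).  Not here: the closed form through `(1 ± i√7)/2`.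

Theorems only (no `def`, no instance, no notation, no named fact — net debt 0).
-/

namespace Literature.Combinatorics.Enumerative

namespace PermContainsPattern

open Finset Equiv

variable {n m k : ℕ}

/-! ### §1 «the largest letters decreasingly ordered»: `β ⊕ (1 ⊖ α)` avoids `312` iff `β` does and `α = w₀` -/

/-- A shifted word `m + α₀, …` has an ascent iff `α` contains `12`. [cite: SimionSchmidt1985, §1 (held text p0002)] -/
theorem has12_ofFn_add_iff (α : Perm (Fin k)) (m : ℕ) :
    (∃ a b : ℕ, [a, b].Sublist (List.ofFn fun j => m + ((α j : Fin k) : ℕ)) ∧ a < b) ↔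
      PermContainsPattern α ![1, 2] := by
  rw [exists_two_sublist_ofFn_iff, contains_12_iff]
  simp only [add_lt_add_iff_left, Fin.val_fin_lt]

/-- ★ `β ⊕ (1 ⊖ α)` avoids `312` iff `β` avoids `312` and `α` avoids `12` (a `312` starting at the largest letter is an
ascent of `α`; one straddling the blocks would need a letter of the high block below a letter of the low block).
[cite: SimionSchmidt1985, Proposition 6 (proof, (3)) (held text p0009)] -/
theorem not_contains_312_blockSum_iff (β : Perm (Fin m)) (α : Perm (Fin k)) :
    ¬ PermContainsPattern (finSumFinEquiv.symm.trans
        ((β.sumCongr ((finRotate (k + 1))⁻¹ * Perm.decomposeFin.symm (0, α))).trans finSumFinEquiv)) ![3, 1, 2] ↔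
      ¬ PermContainsPattern β ![3, 1, 2] ∧ ¬ PermContainsPattern α ![1, 2] := by
  rw [← has312_ofFn_perm_iff, blockSum_word, has312_append_max_iff _ _ (m + k)
    (fun x hx => by
      obtain ⟨i, rfl⟩ := List.mem_ofFn.mp hx
      have := (β i).2; omega)
    (fun y hy => by
      obtain ⟨j, rfl⟩ := List.mem_ofFn.mp hy
      have := (α j).2; omega),
    has312_ofFn_perm_iff, has12_ofFn_add_iff]
  have h3 : ¬ ∃ y ∈ (List.ofFn fun j => m + ((α j : Fin k) : ℕ)), ∃ a b : ℕ,
      [a, b].Sublist (List.ofFn fun i => ((β i : Fin m) : ℕ)) ∧ b < y ∧ y < a := by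
    rintro ⟨y, hy, a, b, hs, -, hya⟩
    obtain ⟨j, rfl⟩ := List.mem_ofFn.mp hy
    have ha : a ∈ (List.ofFn fun i => ((β i : Fin m) : ℕ)) := hs.subset (by simp)
    obtain ⟨i, rfl⟩ := List.mem_ofFn.mp ha
    have := (β i).2; omega
  constructor
  · intro h
    exact ⟨fun hb => h (Or.inl hb), fun ha => h (Or.inr (Or.inl ha))⟩
  · rintro ⟨hb, ha⟩ (h | h | h)
    exacts [hb h, ha h, h3 h]

/-- The decreasing permutation `w₀` avoids `12`. [cite: SimionSchmidt1985, Proposition 6 (proof, (2)) (held text p0009)] -/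
theorem not_contains_12_revPerm (k : ℕ) : ¬ PermContainsPattern (Fin.revPerm : Perm (Fin k)) ![1, 2] := by
  rw [not_contains_12_iff]
  intro i j hij
  simpa using hij

/-- A permutation avoids `12` iff it is `w₀`. [cite: SimionSchmidt1985, Proposition 6 (proof, (2)–(3)) (held text p0009)] -/
theorem not_contains_12_iff_eq_revPerm (α : Perm (Fin k)) : ¬ PermContainsPattern α ![1, 2] ↔ α = Fin.revPerm := by
  constructor
  · intro h
    exact eq_revPerm_of_strictAnti ((not_contains_12_iff α).mp h)
  · rintro rfl
    exact not_contains_12_revPerm k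

/-- `w₀` avoids `231`. [cite: SimionSchmidt1985, Proposition 6 (proof, (2)) (held text p0009)] -/
theorem not_contains_231_revPerm (k : ℕ) : ¬ PermContainsPattern (Fin.revPerm : Perm (Fin k)) ![2, 3, 1] :=
  not_contains_revPerm_of_not_strictAnti (by decide) k

/-- `(−1)^k (−1)^{⌊k/2⌋} = (−1)^{⌊(k+1)/2⌋}` — the sign `(−1)^{C(k+1, 2)}` of the block `w₀^{(k+1)} = 1 ⊖ w₀^{(k)}`.
[cite: SimionSchmidt1985, Proposition 6 (proof: «`sign(σ) = (−1)^{Σ C(x_i,2)}`») (held text p0009)] -/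
theorem neg_one_pow_mul_neg_one_pow_div_two (k : ℕ) : (-1 : ℤ) ^ k * (-1) ^ (k / 2) = (-1) ^ ((k + 1) / 2) := by
  rcases Nat.even_or_odd k with ⟨r, rfl⟩ | ⟨r, rfl⟩
  · rw [Even.neg_one_pow ⟨r, rfl⟩, one_mul, show (r + r) / 2 = r by omega, show (r + r + 1) / 2 = r by omega]
  · rw [Odd.neg_one_pow ⟨r, rfl⟩, show (2 * r + 1) / 2 = r by omega, show (2 * r + 1 + 1) / 2 = r + 1 by omega,
      pow_succ, mul_comm]

/-! ### §2 The signed recurrence for `δ_n = Σ_{σ ∈ S_n(231,312)} sign σ` -/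

/-- Relabelling along `finCongr` does not change pattern containment. [folklore] -/
private theorem contains_finCongr_permCongr_iff' {a b j : ℕ} (h : a = b) (v : Perm (Fin a)) (p : Fin j → ℕ) :
    PermContainsPattern ((finCongr h).permCongr v) p ↔ PermContainsPattern v p := by
  subst h
  rw [show (finCongr (rfl : a = a)).permCongr v = v from Equiv.ext fun x => by simp]

/-- ★★ **The signed recurrence for `231`-avoiding involutions**: `δ_{n+1} = Σ_{m=0}^{n} (−1)^{⌊(n−m+1)/2⌋} δ_m`
(a `231`-avoiding involution with `n` in position `m` is `β ⊕ w₀^{(n−m+1)}`, `β ∈ S_m(231,312)`, of sign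
`(−1)^{C(n−m+1, 2)} sign β`; the compositions of the printed proof, by their last summand).
[cite: SimionSchmidt1985, Proposition 6 (proof) (held text p0009–p0010)] -/
theorem signSum_av231_av312_succ
    [∀ j, DecidablePred fun v : Perm (Fin j) => ¬ PermContainsPattern v ![2, 3, 1] ∧ ¬ PermContainsPattern v ![3, 1, 2]]
    (n : ℕ) :
    ∑ v ∈ (univ.filter fun v : Perm (Fin (n + 1)) =>
        ¬ PermContainsPattern v ![2, 3, 1] ∧ ¬ PermContainsPattern v ![3, 1, 2]), ((Perm.sign v : ℤˣ) : ℤ) =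
      ∑ m ∈ range (n + 1), (-1) ^ ((n - m + 1) / 2) *
        ∑ v ∈ (univ.filter fun v : Perm (Fin m) =>
          ¬ PermContainsPattern v ![2, 3, 1] ∧ ¬ PermContainsPattern v ![3, 1, 2]), ((Perm.sign v : ℤˣ) : ℤ) := by
  classical
  have hh : ∀ p : Fin (n + 1), (p : ℕ) + ((n - p) + 1) = n + 1 := fun p => by omega
  let G : (p : Fin (n + 1)) → Perm (Fin p) × Perm (Fin (n - p)) → Perm (Fin (n + 1)) := fun p q =>
    (finCongr (hh p)).permCongr (finSumFinEquiv.symm.trans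
      ((q.1.sumCongr ((finRotate (n - p + 1))⁻¹ * Perm.decomposeFin.symm (0, q.2))).trans finSumFinEquiv))
  let Av : (j : ℕ) → Finset (Perm (Fin j)) := fun j =>
    univ.filter fun v : Perm (Fin j) => ¬ PermContainsPattern v ![2, 3, 1] ∧ ¬ PermContainsPattern v ![3, 1, 2]
  let img : Fin (n + 1) → Finset (Perm (Fin (n + 1))) := fun p =>
    (Av p ×ˢ ({Fin.revPerm} : Finset (Perm (Fin (n - p))))).image (G p)
  let fib : Fin (n + 1) → Finset (Perm (Fin (n + 1))) := fun p =>
    (Av (n + 1)).filter fun v => v.symm (Fin.last n) = p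
  have hGdef : ∀ p q, G p q = (finCongr (hh p)).permCongr (finSumFinEquiv.symm.trans
      ((q.1.sumCongr ((finRotate (n - p + 1))⁻¹ * Perm.decomposeFin.symm (0, q.2))).trans finSumFinEquiv)) :=
    fun p q => rfl
  have hAv : ∀ j (v : Perm (Fin j)), v ∈ Av j ↔ ¬ PermContainsPattern v ![2, 3, 1] ∧ ¬ PermContainsPattern v ![3, 1, 2] :=
    fun j v => by simp only [Av, Finset.mem_filter, Finset.mem_univ, true_and]
  have hcardAv : ∀ j, (Av j).card = 2 ^ (j - 1) := fun j => by
    rw [← card_av231_av312 j, Nat.card_eq_fintype_card, Fintype.card_subtype]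
  have hGinj : ∀ p, Function.Injective (G p) := fun p q q' e =>
    blockSum_injective _ _ ((Equiv.injective _) e)
  have hGsign : ∀ (p : Fin (n + 1)) (β : Perm (Fin p)),
      ((Perm.sign (G p (β, Fin.revPerm)) : ℤˣ) : ℤ) = (-1) ^ ((n - p + 1) / 2) * ((Perm.sign β : ℤˣ) : ℤ) := by
    intro p β
    rw [hGdef, Perm.sign_permCongr, sign_blockSum, sign_revPerm, mul_right_comm, neg_one_pow_mul_neg_one_pow_div_two]
  -- the image lies in the fibre …
  have hsub : ∀ p, img p ⊆ fib p := by
    intro p v hv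
    obtain ⟨q, hq, rfl⟩ := Finset.mem_image.mp hv
    rw [Finset.mem_product, hAv, Finset.mem_singleton] at hq
    obtain ⟨⟨hb1, hb2⟩, hq2⟩ := hq
    refine Finset.mem_filter.mpr ⟨(hAv _ _).mpr ⟨?_, ?_⟩, ?_⟩
    · rw [hGdef, contains_finCongr_permCongr_iff', not_contains_231_blockSum_iff, hq2]
      exact ⟨hb1, not_contains_231_revPerm _⟩
    · rw [hGdef, contains_finCongr_permCongr_iff', not_contains_312_blockSum_iff, hq2]
      exact ⟨hb2, not_contains_12_revPerm _⟩
    · rw [Equiv.symm_apply_eq, hGdef, blockSum_apply_pos]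
  -- … and exhausts it, by counting: `Σ_p #img_p = Σ_p 2^{p−1} = 2^n = #S_{n+1}(231,312) = Σ_p #fib_p`
  have hcard_img : ∀ p : Fin (n + 1), (img p).card = 2 ^ ((p : ℕ) - 1) := fun p => by
    simp only [img]
    rw [Finset.card_image_of_injective _ (hGinj p), Finset.card_product, hcardAv, Finset.card_singleton, mul_one]
  have hsum_fib : ∑ p, (fib p).card = 2 ^ n := by
    simp only [fib]
    rw [← Finset.card_eq_sum_card_fiberwise (fun v _ => Finset.mem_univ _), hcardAv, Nat.add_sub_cancel]
  have hsum_pow : ∑ p : Fin (n + 1), 2 ^ ((p : ℕ) - 1) = 2 ^ n := by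
    rw [Fin.sum_univ_eq_sum_range (fun i => 2 ^ (i - 1)) (n + 1), sum_range_succ_two_pow_pred]
  have heq : ∀ p, img p = fib p := by
    have hle : ∀ p ∈ (univ : Finset (Fin (n + 1))), (img p).card ≤ (fib p).card :=
      fun p _ => Finset.card_le_card (hsub p)
    have hsums : ∑ p, (img p).card = ∑ p, (fib p).card := by
      rw [hsum_fib, ← hsum_pow]
      exact Finset.sum_congr rfl fun p _ => hcard_img p
    have h := (Finset.sum_eq_sum_iff_of_le hle).mp hsums
    exact fun p => Finset.eq_of_subset_of_card_le (hsub p) (h p (Finset.mem_univ _)).ge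
  -- sum fibrewise
  calc ∑ v ∈ Av (n + 1), ((Perm.sign v : ℤˣ) : ℤ)
      = ∑ p, ∑ v ∈ fib p, ((Perm.sign v : ℤˣ) : ℤ) :=
        (Finset.sum_fiberwise (Av (n + 1)) (fun v => v.symm (Fin.last n)) _).symm
    _ = ∑ p, ∑ v ∈ img p, ((Perm.sign v : ℤˣ) : ℤ) := Finset.sum_congr rfl fun p _ => by rw [heq]
    _ = ∑ p : Fin (n + 1), (-1) ^ ((n - p + 1) / 2) * ∑ β ∈ Av p, ((Perm.sign β : ℤˣ) : ℤ) := by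
        refine Finset.sum_congr rfl fun p _ => ?_
        simp only [img]
        rw [Finset.sum_image fun q _ q' _ e => hGinj p e, Finset.sum_product, Finset.mul_sum]
        refine Finset.sum_congr rfl fun β _ => ?_
        rw [Finset.sum_singleton, hGsign]
    _ = _ := Fin.sum_univ_eq_sum_range
          (fun m => (-1) ^ ((n - m + 1) / 2) * ∑ v ∈ Av m, ((Perm.sign v : ℤˣ) : ℤ)) (n + 1)

/-! ### §3 «the recurrence `δ_n = δ_{n−1} − 2δ_{n−2}`» and the first values -/

/-- `δ_0 = 1`. [cite: SimionSchmidt1985, §2 Remarks after Proposition 6 (held text p0010)] -/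
theorem signSum_av231_av312_zero
    [∀ j, DecidablePred fun v : Perm (Fin j) => ¬ PermContainsPattern v ![2, 3, 1] ∧ ¬ PermContainsPattern v ![3, 1, 2]] :
    ∑ v ∈ (univ.filter fun v : Perm (Fin 0) =>
        ¬ PermContainsPattern v ![2, 3, 1] ∧ ¬ PermContainsPattern v ![3, 1, 2]), ((Perm.sign v : ℤˣ) : ℤ) = 1 := by
  have huniv : (univ : Finset (Perm (Fin 0))) = {1} := by
    ext v
    simp only [Finset.mem_univ, Finset.mem_singleton, true_iff]
    exact Subsingleton.elim v 1
  rw [huniv, Finset.filter_singleton, if_pos ⟨not_contains_of_lt _ _ (by norm_num), not_contains_of_lt _ _ (by norm_num)⟩,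
    Finset.sum_singleton, Perm.sign_one, Units.val_one]

/-- `δ_1 = 1`. [cite: SimionSchmidt1985, §2 Remarks after Proposition 6 (held text p0010)] -/
theorem signSum_av231_av312_one
    [∀ j, DecidablePred fun v : Perm (Fin j) => ¬ PermContainsPattern v ![2, 3, 1] ∧ ¬ PermContainsPattern v ![3, 1, 2]] :
    ∑ v ∈ (univ.filter fun v : Perm (Fin 1) =>
        ¬ PermContainsPattern v ![2, 3, 1] ∧ ¬ PermContainsPattern v ![3, 1, 2]), ((Perm.sign v : ℤˣ) : ℤ) = 1 := by
  rw [signSum_av231_av312_succ, Finset.sum_range_one, signSum_av231_av312_zero]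
  simp

/-- `δ_2 = 0`. [cite: SimionSchmidt1985, §2 Remarks after Proposition 6 (held text p0010)] -/
theorem signSum_av231_av312_two
    [∀ j, DecidablePred fun v : Perm (Fin j) => ¬ PermContainsPattern v ![2, 3, 1] ∧ ¬ PermContainsPattern v ![3, 1, 2]] :
    ∑ v ∈ (univ.filter fun v : Perm (Fin 2) =>
        ¬ PermContainsPattern v ![2, 3, 1] ∧ ¬ PermContainsPattern v ![3, 1, 2]), ((Perm.sign v : ℤˣ) : ℤ) = 0 := by
  rw [signSum_av231_av312_succ, Finset.sum_range_succ, Finset.sum_range_one, signSum_av231_av312_zero,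
    signSum_av231_av312_one]
  simp

/-- ★★ **«the recurrence `δ_n = δ_{n−1} − 2δ_{n−2}`»** (`n ≥ 3`; here as `δ_{n+3} = δ_{n+2} − 2δ_{n+1}` for all `n`):
in `δ_{n+3} = Σ_{m ≤ n+2} (−1)^{⌊(n+3−m)/2⌋} δ_m` the two top terms are `δ_{n+2} − δ_{n+1}` and the rest is
`−Σ_{m ≤ n} (−1)^{⌊(n+1−m)/2⌋} δ_m = −δ_{n+1}`. [cite: SimionSchmidt1985, §2 Remarks after Proposition 6 (held text p0010)] -/
theorem signSum_av231_av312_rec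
    [∀ j, DecidablePred fun v : Perm (Fin j) => ¬ PermContainsPattern v ![2, 3, 1] ∧ ¬ PermContainsPattern v ![3, 1, 2]]
    (n : ℕ) :
    ∑ v ∈ (univ.filter fun v : Perm (Fin (n + 3)) =>
        ¬ PermContainsPattern v ![2, 3, 1] ∧ ¬ PermContainsPattern v ![3, 1, 2]), ((Perm.sign v : ℤˣ) : ℤ) =
      (∑ v ∈ (univ.filter fun v : Perm (Fin (n + 2)) =>
          ¬ PermContainsPattern v ![2, 3, 1] ∧ ¬ PermContainsPattern v ![3, 1, 2]), ((Perm.sign v : ℤˣ) : ℤ)) -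
        2 * ∑ v ∈ (univ.filter fun v : Perm (Fin (n + 1)) =>
          ¬ PermContainsPattern v ![2, 3, 1] ∧ ¬ PermContainsPattern v ![3, 1, 2]), ((Perm.sign v : ℤˣ) : ℤ) := by
  rw [signSum_av231_av312_succ (n + 2), Finset.sum_range_succ, Finset.sum_range_succ, signSum_av231_av312_succ n,
    Nat.sub_self, show (n + 2 - (n + 1) + 1) / 2 = 1 by omega, pow_one, show (0 + 1) / 2 = 0 by omega, pow_zero, one_mul,
    neg_one_mul]
  have h : ∑ m ∈ range (n + 1), (-1 : ℤ) ^ ((n + 2 - m + 1) / 2) *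
      ∑ v ∈ (univ.filter fun v : Perm (Fin m) => ¬ PermContainsPattern v ![2, 3, 1] ∧ ¬ PermContainsPattern v ![3, 1, 2]),
        ((Perm.sign v : ℤˣ) : ℤ) =
      -∑ m ∈ range (n + 1), (-1 : ℤ) ^ ((n - m + 1) / 2) *
      ∑ v ∈ (univ.filter fun v : Perm (Fin m) => ¬ PermContainsPattern v ![2, 3, 1] ∧ ¬ PermContainsPattern v ![3, 1, 2]),
        ((Perm.sign v : ℤˣ) : ℤ) := by
    rw [← Finset.sum_neg_distrib]
    refine Finset.sum_congr rfl fun m hm => ?_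
    rw [Finset.mem_range] at hm
    rw [show (n + 2 - m + 1) / 2 = (n - m + 1) / 2 + 1 by omega, pow_succ, mul_neg_one, neg_mul]
  rw [h]
  ring

/-- `δ_3 = −2` (the `231`-avoiding involutions `123, 132, 213, 321` have signs `+, −, −, −`).
[cite: SimionSchmidt1985, §2 Remarks after Proposition 6 (held text p0010)] -/
theorem signSum_av231_av312_three
    [∀ j, DecidablePred fun v : Perm (Fin j) => ¬ PermContainsPattern v ![2, 3, 1] ∧ ¬ PermContainsPattern v ![3, 1, 2]] :
    ∑ v ∈ (univ.filter fun v : Perm (Fin 3) =>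
        ¬ PermContainsPattern v ![2, 3, 1] ∧ ¬ PermContainsPattern v ![3, 1, 2]), ((Perm.sign v : ℤˣ) : ℤ) = -2 := by
  rw [signSum_av231_av312_rec 0, signSum_av231_av312_two, signSum_av231_av312_one]
  norm_num

/-- `δ_4 = −2`. [cite: SimionSchmidt1985, §2 Remarks after Proposition 6 (held text p0010)] -/
theorem signSum_av231_av312_four
    [∀ j, DecidablePred fun v : Perm (Fin j) => ¬ PermContainsPattern v ![2, 3, 1] ∧ ¬ PermContainsPattern v ![3, 1, 2]] :
    ∑ v ∈ (univ.filter fun v : Perm (Fin 4) =>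
        ¬ PermContainsPattern v ![2, 3, 1] ∧ ¬ PermContainsPattern v ![3, 1, 2]), ((Perm.sign v : ℤˣ) : ℤ) = -2 := by
  rw [signSum_av231_av312_rec 1, signSum_av231_av312_three, signSum_av231_av312_two]
  norm_num

/-! ### §4 «`δ_n ≡ 2 (mod 4)`, `n ≥ 3`» and «`δ_n ≠ 0` for `n ≥ 3`» -/

/-- ★★ **«the recurrence `δ_n = δ_{n−1} − 2δ_{n−2}` implies `δ_n ≡ 2 (mod 4)`, `n ≥ 3`»**.
[cite: SimionSchmidt1985, §2 Remarks after Proposition 6 (held text p0010)] -/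
theorem signSum_av231_av312_emod_four
    [∀ j, DecidablePred fun v : Perm (Fin j) => ¬ PermContainsPattern v ![2, 3, 1] ∧ ¬ PermContainsPattern v ![3, 1, 2]]
    (n : ℕ) (hn : 3 ≤ n) :
    (∑ v ∈ (univ.filter fun v : Perm (Fin n) =>
        ¬ PermContainsPattern v ![2, 3, 1] ∧ ¬ PermContainsPattern v ![3, 1, 2]), ((Perm.sign v : ℤˣ) : ℤ)) % 4 = 2 := by
  -- two-step induction on `n ≥ 3`
  have key : ∀ j : ℕ,
      (∑ v ∈ (univ.filter fun v : Perm (Fin (j + 3)) =>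
          ¬ PermContainsPattern v ![2, 3, 1] ∧ ¬ PermContainsPattern v ![3, 1, 2]), ((Perm.sign v : ℤˣ) : ℤ)) % 4 = 2 ∧
      (∑ v ∈ (univ.filter fun v : Perm (Fin (j + 4)) =>
          ¬ PermContainsPattern v ![2, 3, 1] ∧ ¬ PermContainsPattern v ![3, 1, 2]), ((Perm.sign v : ℤˣ) : ℤ)) % 4 = 2 := by
    intro j
    induction j with
    | zero => exact ⟨by rw [signSum_av231_av312_three]; rfl, by rw [signSum_av231_av312_four]; rfl⟩
    | succ j ih =>
      refine ⟨ih.2, ?_⟩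
      have h : ∑ v ∈ (univ.filter fun v : Perm (Fin (j + 1 + 4)) =>
            ¬ PermContainsPattern v ![2, 3, 1] ∧ ¬ PermContainsPattern v ![3, 1, 2]), ((Perm.sign v : ℤˣ) : ℤ) =
          (∑ v ∈ (univ.filter fun v : Perm (Fin (j + 4)) =>
              ¬ PermContainsPattern v ![2, 3, 1] ∧ ¬ PermContainsPattern v ![3, 1, 2]), ((Perm.sign v : ℤˣ) : ℤ)) -
            2 * ∑ v ∈ (univ.filter fun v : Perm (Fin (j + 3)) =>
              ¬ PermContainsPattern v ![2, 3, 1] ∧ ¬ PermContainsPattern v ![3, 1, 2]), ((Perm.sign v : ℤˣ) : ℤ) :=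
        signSum_av231_av312_rec (j + 2)
      omega
  obtain ⟨j, rfl⟩ : ∃ j, n = j + 3 := ⟨n - 3, by omega⟩
  exact (key j).1

/-- ★★ **«`δ_n ≠ 0` for `n ≥ 3`»**: for `n ≥ 3` the numbers of even and of odd `231`-avoiding involutions of length `n`
differ. [cite: SimionSchmidt1985, §2 Remarks after Proposition 6 (held text p0010)] -/
theorem signSum_av231_av312_ne_zero
    [∀ j, DecidablePred fun v : Perm (Fin j) => ¬ PermContainsPattern v ![2, 3, 1] ∧ ¬ PermContainsPattern v ![3, 1, 2]]
    (n : ℕ) (hn : 3 ≤ n) :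
    ∑ v ∈ (univ.filter fun v : Perm (Fin n) =>
        ¬ PermContainsPattern v ![2, 3, 1] ∧ ¬ PermContainsPattern v ![3, 1, 2]), ((Perm.sign v : ℤˣ) : ℤ) ≠ 0 := by
  intro h
  have := signSum_av231_av312_emod_four n hn
  rw [h] at this
  exact absurd this (by decide)

/-! ### §5 The numbers `EI_n(231)`, `OI_n(231)` of even and odd `231`-avoiding involutions -/

section EvenOdd

/-- `Σ_{σ ∈ S} sign σ = #{even σ ∈ S} − #{odd σ ∈ S}` and `#S = #even + #odd`. [folklore] -/
private theorem sum_sign_eq_and_card_eq (S : Finset (Perm (Fin n))) :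
    ∑ v ∈ S, ((Perm.sign v : ℤˣ) : ℤ) =
        ((S.filter fun v => Perm.sign v = 1).card : ℤ) - ((S.filter fun v => Perm.sign v = -1).card : ℤ) ∧
      S.card = (S.filter fun v => Perm.sign v = 1).card + (S.filter fun v => Perm.sign v = -1).card := by
  have hneg : S.filter (fun v => ¬ Perm.sign v = 1) = S.filter (fun v => Perm.sign v = -1) :=
    Finset.filter_congr fun v _ => ⟨fun h => (Int.units_eq_one_or (Perm.sign v)).resolve_left h,
      fun h h' => absurd (h'.symm.trans h) (by decide)⟩
  constructor
  · rw [← Finset.sum_filter_add_sum_filter_not S (fun v => Perm.sign v = 1)]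
    have h1 : ∑ v ∈ S.filter (fun v => Perm.sign v = 1), ((Perm.sign v : ℤˣ) : ℤ) =
        ((S.filter fun v => Perm.sign v = 1).card : ℤ) := by
      rw [Finset.card_eq_sum_ones, Nat.cast_sum]
      refine Finset.sum_congr rfl fun v hv => ?_
      rw [(Finset.mem_filter.mp hv).2, Units.val_one, Nat.cast_one]
    have h2 : ∑ v ∈ S.filter (fun v => ¬ Perm.sign v = 1), ((Perm.sign v : ℤˣ) : ℤ) =
        -((S.filter fun v => Perm.sign v = -1).card : ℤ) := by
      rw [hneg, Finset.card_eq_sum_ones, Nat.cast_sum, ← Finset.sum_neg_distrib]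
      refine Finset.sum_congr rfl fun v hv => ?_
      rw [(Finset.mem_filter.mp hv).2, Units.val_neg, Units.val_one, Nat.cast_one]
    rw [h1, h2, sub_eq_add_neg]
  · rw [← Finset.card_filter_add_card_filter_not (fun v => Perm.sign v = 1), hneg]

/-- `EI_n(231) − OI_n(231) = δ_n` and `EI_n(231) + OI_n(231) = I_n(231) = 2^{n−1}`, with
`EI_n(231) = #{v | v² = 1, v avoids 231, sign v = 1}` etc. [cite: SimionSchmidt1985, Proposition 6 (held text p0009)] -/
theorem card_even_odd_involutions_av231 (n : ℕ)
    [DecidablePred fun v : Perm (Fin n) => ¬ PermContainsPattern v ![2, 3, 1] ∧ ¬ PermContainsPattern v ![3, 1, 2]] :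
    (Nat.card {v : Perm (Fin n) // v * v = 1 ∧ ¬ PermContainsPattern v ![2, 3, 1] ∧ Perm.sign v = 1} : ℤ) -
        Nat.card {v : Perm (Fin n) // v * v = 1 ∧ ¬ PermContainsPattern v ![2, 3, 1] ∧ Perm.sign v = -1} =
        ∑ v ∈ (univ.filter fun v : Perm (Fin n) =>
          ¬ PermContainsPattern v ![2, 3, 1] ∧ ¬ PermContainsPattern v ![3, 1, 2]), ((Perm.sign v : ℤˣ) : ℤ) ∧
      Nat.card {v : Perm (Fin n) // v * v = 1 ∧ ¬ PermContainsPattern v ![2, 3, 1] ∧ Perm.sign v = 1} +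
        Nat.card {v : Perm (Fin n) // v * v = 1 ∧ ¬ PermContainsPattern v ![2, 3, 1] ∧ Perm.sign v = -1} = 2 ^ (n - 1) := by
  classical
  set S : Finset (Perm (Fin n)) := univ.filter fun v : Perm (Fin n) =>
    ¬ PermContainsPattern v ![2, 3, 1] ∧ ¬ PermContainsPattern v ![3, 1, 2] with hS
  have hE : Nat.card {v : Perm (Fin n) // v * v = 1 ∧ ¬ PermContainsPattern v ![2, 3, 1] ∧ Perm.sign v = 1} =
      (S.filter fun v => Perm.sign v = 1).card := by
    rw [Nat.card_congr (Equiv.subtypeEquivRight (fun v => show _ ↔ (¬ PermContainsPattern v ![2, 3, 1] ∧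
        ¬ PermContainsPattern v ![3, 1, 2]) ∧ Perm.sign v = 1 by rw [← involution_and_av231_iff, and_assoc])),
      Nat.card_eq_fintype_card, Fintype.card_subtype, hS, Finset.filter_filter]
  have hO : Nat.card {v : Perm (Fin n) // v * v = 1 ∧ ¬ PermContainsPattern v ![2, 3, 1] ∧ Perm.sign v = -1} =
      (S.filter fun v => Perm.sign v = -1).card := by
    rw [Nat.card_congr (Equiv.subtypeEquivRight (fun v => show _ ↔ (¬ PermContainsPattern v ![2, 3, 1] ∧
        ¬ PermContainsPattern v ![3, 1, 2]) ∧ Perm.sign v = -1 by rw [← involution_and_av231_iff, and_assoc])),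
      Nat.card_eq_fintype_card, Fintype.card_subtype, hS, Finset.filter_filter]
  have hA : S.card = 2 ^ (n - 1) := by
    rw [hS, ← card_av231_av312 n, Nat.card_eq_fintype_card, Fintype.card_subtype]
  obtain ⟨h1, h2⟩ := sum_sign_eq_and_card_eq S
  rw [hE, hO, h1, ← hA, h2]
  exact ⟨rfl, rfl⟩

/-- ★★ **`EI_n(231) ≠ OI_n(231)` for `n ≥ 3`** («`δ_n ≠ 0` for `n ≥ 3`»). [cite: SimionSchmidt1985, §2 Remarks after Proposition 6 (held text p0010)] -/
theorem card_even_involutions_av231_ne_card_odd (n : ℕ) (hn : 3 ≤ n) :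
    Nat.card {v : Perm (Fin n) // v * v = 1 ∧ ¬ PermContainsPattern v ![2, 3, 1] ∧ Perm.sign v = 1} ≠
      Nat.card {v : Perm (Fin n) // v * v = 1 ∧ ¬ PermContainsPattern v ![2, 3, 1] ∧ Perm.sign v = -1} := by
  classical
  intro h
  have h1 := (card_even_odd_involutions_av231 n).1
  rw [h, sub_self] at h1
  exact signSum_av231_av312_ne_zero n hn h1.symm

/-- ★ `(EI_n(231) − OI_n(231)) ≡ 2 (mod 4)` for `n ≥ 3`. [cite: SimionSchmidt1985, §2 Remarks after Proposition 6 (held text p0010)] -/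
theorem card_even_sub_card_odd_involutions_av231_emod_four (n : ℕ) (hn : 3 ≤ n) :
    ((Nat.card {v : Perm (Fin n) // v * v = 1 ∧ ¬ PermContainsPattern v ![2, 3, 1] ∧ Perm.sign v = 1} : ℤ) -
        Nat.card {v : Perm (Fin n) // v * v = 1 ∧ ¬ PermContainsPattern v ![2, 3, 1] ∧ Perm.sign v = -1}) % 4 = 2 := by
  classical
  rw [(card_even_odd_involutions_av231 n).1]
  exact signSum_av231_av312_emod_four n hn

/-- `EI_2(231) = OI_2(231)` (`= 1`: the identity and the transposition): `δ_2 = 0`, the one exception to `δ_n ≠ 0`.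
[cite: SimionSchmidt1985, §2 Remarks after Proposition 6 (held text p0010)] -/
theorem card_even_involutions_av231_two :
    Nat.card {v : Perm (Fin 2) // v * v = 1 ∧ ¬ PermContainsPattern v ![2, 3, 1] ∧ Perm.sign v = 1} =
      Nat.card {v : Perm (Fin 2) // v * v = 1 ∧ ¬ PermContainsPattern v ![2, 3, 1] ∧ Perm.sign v = -1} := by
  classical
  have h1 := (card_even_odd_involutions_av231 2).1
  rw [signSum_av231_av312_two] at h1
  omega

/-- «The same results hold for `312`-avoiding involutions» — indeed the `312`-avoiding involutions ARE the `231`-avoiding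
ones (`InvolutionsAvoiding231.lean`): `EI_n(312) = EI_n(231)`, `OI_n(312) = OI_n(231)`.
[cite: SimionSchmidt1985, Proposition 6 and Remarks (held text p0010)] -/
theorem card_signed_involutions_av312_eq (n : ℕ) (ε : ℤˣ) :
    Nat.card {v : Perm (Fin n) // v * v = 1 ∧ ¬ PermContainsPattern v ![3, 1, 2] ∧ Perm.sign v = ε} =
      Nat.card {v : Perm (Fin n) // v * v = 1 ∧ ¬ PermContainsPattern v ![2, 3, 1] ∧ Perm.sign v = ε} :=
  Nat.card_congr (Equiv.subtypeEquivRight fun v => by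
    rw [← and_assoc, ← and_assoc, involution_and_av231_iff_involution_and_av312])

/-- Hence `EI_n(312) ≠ OI_n(312)` for `n ≥ 3` as well. [cite: SimionSchmidt1985, Proposition 6 and Remarks (held text p0010)] -/
theorem card_even_involutions_av312_ne_card_odd (n : ℕ) (hn : 3 ≤ n) :
    Nat.card {v : Perm (Fin n) // v * v = 1 ∧ ¬ PermContainsPattern v ![3, 1, 2] ∧ Perm.sign v = 1} ≠
      Nat.card {v : Perm (Fin n) // v * v = 1 ∧ ¬ PermContainsPattern v ![3, 1, 2] ∧ Perm.sign v = -1} := by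
  rw [card_signed_involutions_av312_eq, card_signed_involutions_av312_eq]
  exact card_even_involutions_av231_ne_card_odd n hn

end EvenOdd

end PermContainsPattern

end Literature.Combinatorics.Enumerative
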